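import Summits.BirchSwinnertonDyer.BirchSwinnertonDyer.Theorems.PrintCFramBottomClassIndexLawFiveLeHerbrandRationalParity

/-!
# Road C, stub D (Galois half), file 6: the two Galois inputs `hrc`, `hdec` of w8 g0's stub-E theorem
# `HerbrandKummer.evenVanish_range_final_of_teichmuller` (p657289), transported from `Γ_ℚ`-currency

Summit `BirchSwinnertonDyer`, crux `PrintCFram.BottomClassIndexLawFiveLe` (stmt-BirchSwinnertonDyer-20372), line
`eisenstein-resource-bdp-line`, Stub H′, registry v12 (`stub_lineDictionary` = D, `stub_evenVanishing_of_mazurWiles` = E); width seat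
`bsd-line-cfram-p1-w4` g5, typing item «D-gal» (w8 g0, STATUS 18:29Z/18:35Z: «D-gal owes E exactly hrc + hdec»).  HONEST FRAMING:
Galois bookkeeping only; no summit statement is proved here, no stub is closed.

* **`exists_absGaloisQuot_eq_complexConj_and_apply_eq_one`** = w8's `hrc`: for `K` CM Galois over `ℚ`, a complex conjugation `c_∞ ∈ Γ_ℚ` and
  `r c_∞ = 1` (the EVEN lift, `odd_and_even_or`): `∃ γ, absGaloisQuot ℚ K γ = (complexConj K).restrictScalars ℚ ∧ r γ = 1`.
* `autToPow_absGaloisQuot_eq` (`hζ.autToPow ℚ γ̄ = χ̄_p γ`: the `ζ`-exponent of `γ̄` IS the mod-`p` cyclotomic character);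
  `absGaloisQuot_smul_under_eq_of_mem_decompositionSubgroup` (`g ∈ D_𝔓`, `𝔓 = ι⁻¹𝔔`, `𝔔` above `v` ⟹ `ḡ • v = v`);
  **`hdec_of_forall_primesAbove`** = w8's `hdec` from LEAD g9's `Γ_ℚ`-form «`∀ ℓ ∋ p, ∀ 𝔓 ∈ ℓ.primesAbove, ∃ g ∈ D_𝔓, r g ≠ χ̄_p g`».

References: J. Neukirch, *Algebraic Number Theory*, Ch. I §9, Ch. IV §1 [NeukirchANT1999]; w8 g0's p657289.
-/

noncomputable section

-- summit-side namespace `Summit.BirchSwinnertonDyer.BirchSwinnertonDyer.…` (single-conjunct summit, D-0017 layout)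
set_option linter.dupNamespace false
set_option autoImplicit false

open scoped Classical Pointwise
open NumberField IsDedekindDomain Field
open Literature.NumberTheory.GaloisRepresentations

namespace Summit.BirchSwinnertonDyer.BirchSwinnertonDyer.Theorems.PrintCFram.HerbrandSelmerToHom

section Decomposition

variable {p : ℕ} {K : Type} [Field K] [NumberField K] [IsGalois ℚ K]

/-- **w8 g0's `hrc`**: a complex conjugation `c_∞` with `r c_∞ = 1` witnesses `∃ γ, γ̄ = complexConj K ∧ r γ = 1` (`K` CM).
[folklore] -/
theorem exists_absGaloisQuot_eq_complexConj_and_apply_eq_one [IsCMField K] {A : Type*} [CommGroup A]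
    (r : absoluteGaloisGroup ℚ →* A) {c : absoluteGaloisGroup ℚ} (hc : IsComplexConjugation (Rat.castHom ℝ) c) (hr : r c = 1) :
    ∃ γ : absoluteGaloisGroup ℚ, absGaloisQuot ℚ K γ = (IsCMField.complexConj K).restrictScalars ℚ ∧ r γ = 1 :=
  ⟨c, absGaloisQuot_eq_complexConj_restrictScalars hc, hr⟩

/-- **The `ζ`-exponent character of `Gal(K/ℚ)` is the mod-`p` cyclotomic character**: `hζ.autToPow ℚ γ̄ = χ̄_p γ`. [folklore] -/
theorem autToPow_absGaloisQuot_eq [Fact p.Prime] {ζ : K} (hζ : IsPrimitiveRoot ζ p) (γ : absoluteGaloisGroup ℚ) :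
    hζ.autToPow ℚ (absGaloisQuot ℚ K γ) = modNCyclotomicCharacter ℚ p γ := by
  have ha : ∀ σ : K ≃ₐ[ℚ] K, σ ζ = ζ ^ ((hζ.autToPow ℚ σ : (ZMod p)ˣ) : ZMod p).val := fun σ => (hζ.autToPow_spec ℚ σ).symm
  have h := natCast_exponent_absGaloisQuot_eq (F := ℚ) hζ (fun σ => ((hζ.autToPow ℚ σ : (ZMod p)ˣ) : ZMod p).val) ha γ
  rw [ZMod.natCast_zmod_val] at h
  exact Units.ext h

omit [IsGalois ℚ K] in
/-- `(p) ⊆ v ∩ ℤ` for a place `v ∋ p`. [folklore] -/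
theorem natCast_mem_under {v : HeightOneSpectrum (𝓞 K)} (hv : ((p : ℕ) : 𝓞 K) ∈ v.asIdeal) :
    ((p : ℕ) : 𝓞 ℚ) ∈ (v.under (𝓞 ℚ)).asIdeal := by
  rw [HeightOneSpectrum.under_asIdeal, Ideal.under_def, Ideal.mem_comap, map_natCast]
  exact hv

/-- **`g ∈ D_𝔓 ⟹ ḡ • v = v`** for `𝔓 = ι⁻¹𝔔` with `𝔔` a prime of `\bar ℤ_K` above the place `v` of `K` (`ḡ = absGaloisQuot ℚ K g`; the place
below `g ⋆ 𝔔` is `ḡ • v`, tree `under_outerConjIdeal`). [cite: NeukirchANT1999, Ch. I §9] -/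
theorem absGaloisQuot_smul_eq_of_mem_decompositionSubgroup {v : HeightOneSpectrum (𝓞 K)} {𝔔 : Ideal (absIntegers (𝓞 K) K)}
    (h𝔔 : 𝔔 ∈ v.primesAbove) {g : absoluteGaloisGroup ℚ}
    (hg : g ∈ (𝔔.comap (absIntegersMap ℚ K)).decompositionSubgroup (absoluteGaloisGroup ℚ)) :
    absGaloisQuot ℚ K g • v.asIdeal = v.asIdeal := by
  haveI : Algebra.IsAlgebraic ℚ K := inferInstance
  rw [Ideal.mem_decompositionSubgroup_iff] at hg
  have h1 : outerConjIdeal g 𝔔 = 𝔔 :=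
    comap_absIntegersMap_injective ℚ K (by rw [comap_outerConjIdeal, hg])
  rw [h𝔔.2.over, ← under_outerConjIdeal, h1]

/-- **w8 g0's `hdec` from LEAD g9's `Γ_ℚ`-form.** If above every prime `𝔓` of `\bar ℤ` over `p` some `g ∈ D_𝔓` has `r g ≠ χ̄_p g`, then for
every place `v ∋ p` of `K` some `γ ∈ Γ_ℚ` has `γ̄ • v = v` and `hζ.autToPow ℚ γ̄ ≠ r γ`. [cite: NeukirchANT1999, Ch. I §9] -/
theorem hdec_of_forall_primesAbove [Fact p.Prime] {ζ : K} (hζ : IsPrimitiveRoot ζ p) (r : absoluteGaloisGroup ℚ →* (ZMod p)ˣ)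
    (H : ∀ (ℓ : HeightOneSpectrum (𝓞 ℚ)), ((p : ℕ) : 𝓞 ℚ) ∈ ℓ.asIdeal → ∀ 𝔓 ∈ ℓ.primesAbove,
      ∃ g ∈ 𝔓.decompositionSubgroup (absoluteGaloisGroup ℚ), r g ≠ modNCyclotomicCharacter ℚ p g) :
    ∀ v : HeightOneSpectrum (𝓞 K), ((p : ℕ) : 𝓞 K) ∈ v.asIdeal →
      ∃ γ : absoluteGaloisGroup ℚ, absGaloisQuot ℚ K γ • v.asIdeal = v.asIdeal ∧ hζ.autToPow ℚ (absGaloisQuot ℚ K γ) ≠ r γ := by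
  intro v hv
  obtain ⟨𝔔, h𝔔⟩ := v.primesAbove_nonempty
  obtain ⟨g, hg, hne⟩ := H (v.under (𝓞 ℚ)) (natCast_mem_under hv) (𝔔.comap (absIntegersMap ℚ K))
    (comap_absIntegersMap_mem_primesAbove (K := ℚ) (M := K) (v := v.under (𝓞 ℚ)) (w := v) rfl h𝔔)
  refine ⟨g, absGaloisQuot_smul_eq_of_mem_decompositionSubgroup h𝔔 hg, ?_⟩
  rw [autToPow_absGaloisQuot_eq]
  exact fun h => hne h.symm

end Decomposition

end Summit.BirchSwinnertonDyer.BirchSwinnertonDyer.Theorems.PrintCFram.HerbrandSelmerToHom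

end
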